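import Mathlib
import HarnessLib
import Summits.Ventures.LatticeQCDFlow.Scoring.ReplicaError
import Summits.Ventures.LatticeQCDFlow.Scoring.ChainMeanSquareError
import Summits.Ventures.LatticeQCDFlow.Scoring.WarmStartTransfer

/-!
# Independent replica chains: the grand mean of `R` Doeblin chains of length `N` has mean-square
# error `≤ MSE_N / R + (1 − 1/R) · bias_N²` — replicas divide the fluctuation, not the burn-in bias —
# and the median of the replica means is a certified `e^{−R/8}` confidence device

HONEST FRAMING: exact (Metropolis-corrected) sampling algorithms for lattice gauge theory;
figures of merit are autocorrelation/cost numbers at stated couplings and volumes; no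
continuum-physics claim.

Venture `LatticeQCDFlow` (cell pub-lqcd), topic `Scoring`; FANOUT row 8 (`s0-cpn-nemc`, GEN-14).
NEW WORK of the cell, not a published result; no definition is introduced (row 11's
`Scoring.replicaMean` is reused).  Flow-based samplers are run as MANY PARALLEL CHAINS (batched
proposals on an accelerator; independent streams / seeds); the row's any-start certificates
(`Scoring/ChainMeanSquareError.lean`: `E_{μ₀}[(A_N − πf)²] ≤ (2/ε − 1) Var_π f/N + 16C'²/(ε²N²)`;
`Scoring/ChainBurnIn.lean`: `|E_{μ₀} A_N − πf| ≤ 2C'/(εN)`) are per chain.  This file prices the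
GRAND MEAN over `R` independent chains with the same kernel and arbitrary (possibly different)
starts, on any probability space carrying the replicas (Mathlib's `IndepFun` / `iIndepFun`,
`Measure.map`, `Kernel.trajMeasure`), and adds the median-of-means amplification (Chebyshev per
replica, Hoeffding across replicas via Mathlib's `measure_sum_range_ge_le_of_iIndepFun`).
Printed counterpart NAMED ONLY: the "many short chains" bias–variance bookkeeping (Gelman–Rubin
1992; Margossian–Hoffman–Sountsov–Riou-Durand–Vehtari–Gelman 2024, *Nested R̂*) and the
median-of-means estimator (Nemirovsky–Yudin 1983; Devroye–Lerasle–Lugosi–Oliveira 2016), nothing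
cited as a fact.

## Content

Abstract replicas (`Y_0 … Y_{R−1}` real random variables on a probability space, target `c`):
* `integral_sub_const_sq` — `E (Z − c)² = Var Z + (E Z − c)²`;
* **`integral_replicaMean_sub_sq_le`** — pairwise UNCORRELATED square-integrable replicas with
  `|E Y_r − c| ≤ b`, `E (Y_r − c)² ≤ v` ⇒ `E (Ȳ − c)² ≤ v/R + (1 − 1/R) b²` (`Ȳ = replicaMean Y R`);
* `measureReal_abs_sub_ge_le` — Chebyshev about a target: `P(s ≤ |Y − c|) ≤ E(Y − c)²/s²`;
* **`measureReal_half_replicas_far_le`** — MUTUALLY INDEPENDENT replicas with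
  `P(s ≤ |Y_r − c|) ≤ 1/4` each ⇒ `P(#{r < R : s ≤ |Y_r − c|} ≥ R/2) ≤ exp(−R/8)` (on the
  complement every sample median of the `Y_r` is within `s` of `c`);
  `measureReal_half_replicas_far_le_of_sq` — the same from `E (Y_r − c)² ≤ v`, `4v ≤ s²`.

Replica CHAINS (`κ` Markov on `Ω`, invariant probability law `π`, `κ(x, ·) ≥ ε π`, `ε > 0`;
`X_r : Ω' → (ℕ → Ω)` measurable with law `trajMeasure (μ₀ r) κ`, `|f| ≤ C`, `C' = C + |πf|`,
`Y_r = (1/N) Σ_{i<N} f(X_r i)`, `N ≥ 1`):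
* **`replicaChains_mse_le_of_doeblin`** — pairwise independent replicas ⇒
  `E[(Ȳ − πf)²] ≤ ((2/ε − 1) Var_π f/N + 16 C'²/(ε² N²))/R + (1 − 1/R)(2C'/(εN))²`;
* **`replicaChains_mse_le_of_doeblin_stationary`** — all starts `= π` ⇒
  `E[(Ȳ − πf)²] ≤ (2/ε − 1) Var_π f/(R N)`: `R` stationary replicas of length `N` carry the
  certificate of ONE run of length `R N`;
* **`replicaChains_median_confidence_of_doeblin`** — mutually independent replicas and
  `4 ((2/ε − 1) Var_π f/N + 16 C'²/(ε² N²)) ≤ s²` ⇒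
  `P(#{r < R : s ≤ |Y_r − πf|} ≥ R/2) ≤ exp(−R/8)`.

Reading (value-free): parallel chains buy the `1/R` on the fluctuation term only; the squared
burn-in bias `(2C'/(εN))²` keeps the weight `1 − 1/R`, so at fixed total cost `R N` the certified
error is minimised by long chains unless the start is warm (`Scoring/WarmStartTransfer.lean`) or
stationary, where `R` chains of length `N` are worth one chain of length `R N`; and `R` replicas turn
a Chebyshev-level per-chain statement into confidence `1 − e^{−R/8}` for the median, with a radius
driven by `Var_π f` rather than by the range `C'` once `N ≥ 16 C'²/(ε² · (2/ε − 1) Var_π f)`.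
NOT CLAIMED: any `ε` for a concrete sampler; optimality of `1/4`, `1/8`; anything about the
between-replica error ESTIMATOR (row 11's `Scoring/ReplicaError.lean`); unbounded observables.
-/

noncomputable section

namespace Summit.Ventures.LatticeQCDFlow.Scoring

open MeasureTheory ProbabilityTheory Filter Finset
open scoped ENNReal NNReal

/-! ### Abstract replicas on a probability space -/

section Abstract

variable {Ω' : Type*} {mΩ' : MeasurableSpace Ω'} {μ : Measure Ω'} [IsProbabilityMeasure μ]

/-- `E (Z − c)² = Var Z + (E Z − c)²` for square-integrable `Z`. -/
theorem integral_sub_const_sq {Z : Ω' → ℝ} (hZ : MemLp Z 2 μ) (c : ℝ) :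
    ∫ ω, (Z ω - c) ^ 2 ∂μ = Var[Z; μ] + (μ[Z] - c) ^ 2 := by
  have hZc : MemLp (fun ω => Z ω - c) 2 μ := hZ.sub (memLp_const c)
  have h1 : Var[fun ω => Z ω - c; μ] = Var[Z; μ] := variance_sub_const hZ.aestronglyMeasurable c
  have h2 : μ[fun ω => Z ω - c] = μ[Z] - c := by
    show ∫ ω, (Z ω - c) ∂μ = ∫ ω, Z ω ∂μ - c
    rw [integral_sub (hZ.integrable one_le_two) (integrable_const c), integral_const, probReal_univ,
      one_smul]
  have h3 := variance_eq_sub hZc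
  have h4 : μ[(fun ω => Z ω - c) ^ 2] = ∫ ω, (Z ω - c) ^ 2 ∂μ := rfl
  rw [h4, h2, h1] at h3
  linarith

variable {Y : ℕ → Ω' → ℝ} {R : ℕ}

/-- **MEAN-SQUARE ERROR OF THE REPLICA MEAN ABOUT A TARGET.**  For pairwise uncorrelated
square-integrable `Y_0, …, Y_{R−1}` (`R ≥ 1`) with `|E Y_r − c| ≤ b` and `E (Y_r − c)² ≤ v`:
`E (Ȳ − c)² ≤ v/R + (1 − 1/R) b²`, `Ȳ = (1/R) Σ_{r<R} Y_r`. -/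
theorem integral_replicaMean_sub_sq_le (hR : R ≠ 0) (hY : ∀ r < R, MemLp (Y r) 2 μ)
    (hcov : ∀ i < R, ∀ j < R, i ≠ j → cov[Y i, Y j; μ] = 0) {c b v : ℝ}
    (hb : ∀ r < R, |μ[Y r] - c| ≤ b) (hv : ∀ r < R, ∫ ω, (Y r ω - c) ^ 2 ∂μ ≤ v) :
    ∫ ω, (replicaMean Y R ω - c) ^ 2 ∂μ ≤ v / R + (1 - 1 / R) * b ^ 2 := by
  have hRpos : (0 : ℝ) < R := by exact_mod_cast Nat.pos_of_ne_zero hR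
  have hR1 : (1 : ℝ) ≤ R := by exact_mod_cast Nat.one_le_iff_ne_zero.2 hR
  rw [integral_sub_const_sq (memLp_replicaMean hY) c, variance_replicaMean hR hY hcov,
    integral_replicaMean hY]
  -- per replica: Var(Y_r) = E(Y_r − c)² − (E Y_r − c)²
  have hvar : ∀ r ∈ range R, Var[Y r; μ] = ∫ ω, (Y r ω - c) ^ 2 ∂μ - (μ[Y r] - c) ^ 2 :=
    fun r hr => by rw [integral_sub_const_sq (hY r (mem_range.1 hr)) c]; ring
  rw [Finset.sum_congr rfl hvar, Finset.sum_sub_distrib]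
  set S1 := ∑ r ∈ range R, ∫ ω, (Y r ω - c) ^ 2 ∂μ with hS1
  set S2 := ∑ r ∈ range R, (μ[Y r] - c) ^ 2 with hS2
  set T := ∑ r ∈ range R, (μ[Y r] - c) with hT
  have hmean : (∑ r ∈ range R, μ[Y r]) / R - c = T / R := by
    rw [hT, Finset.sum_sub_distrib, Finset.sum_const, Finset.card_range, nsmul_eq_mul]
    field_simp
  rw [hmean]
  have hS1v : S1 ≤ R * v := by
    calc S1 ≤ ∑ _r ∈ range R, v := Finset.sum_le_sum fun r hr => hv r (mem_range.1 hr)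
      _ = R * v := by rw [Finset.sum_const, Finset.card_range, nsmul_eq_mul]
  have hS2b : S2 ≤ R * b ^ 2 := by
    calc S2 ≤ ∑ _r ∈ range R, b ^ 2 := Finset.sum_le_sum fun r hr => by
            have h := hb r (mem_range.1 hr)
            rw [← sq_abs]
            exact pow_le_pow_left₀ (abs_nonneg _) h 2
      _ = R * b ^ 2 := by rw [Finset.sum_const, Finset.card_range, nsmul_eq_mul]
  have hTS : T ^ 2 ≤ R * S2 := by
    have h := sq_sum_le_card_mul_sum_sq (s := range R) (f := fun r => μ[Y r] - c)
    rwa [Finset.card_range] at h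
  have hS20 : 0 ≤ S2 := Finset.sum_nonneg fun r _ => sq_nonneg _
  have key : S1 - S2 + T ^ 2 ≤ R * v + (R - 1) * (R * b ^ 2) := by nlinarith
  have hlhs : (S1 - S2) / (R : ℝ) ^ 2 + (T / R) ^ 2 = (S1 - S2 + T ^ 2) / (R : ℝ) ^ 2 := by
    field_simp
  have hrhs : v / R + (1 - 1 / R) * b ^ 2 = (R * v + (R - 1) * (R * b ^ 2)) / (R : ℝ) ^ 2 := by
    field_simp
  rw [hlhs, hrhs]
  exact div_le_div_of_nonneg_right key (by positivity)

/-- **Chebyshev about a target**: `P(s ≤ |Y − c|) ≤ E(Y − c)²/s²` for `s > 0` and square-integrable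
`Y`. -/
theorem measureReal_abs_sub_ge_le {Z : Ω' → ℝ} (hZ : MemLp Z 2 μ) (c : ℝ) {s : ℝ} (hs : 0 < s) :
    μ.real {ω | s ≤ |Z ω - c|} ≤ (∫ ω, (Z ω - c) ^ 2 ∂μ) / s ^ 2 := by
  have hZc : MemLp (fun ω => Z ω - c) 2 μ := hZ.sub (memLp_const c)
  have hint : Integrable (fun ω => (Z ω - c) ^ 2) μ := hZc.integrable_sq
  have hset : {ω | s ≤ |Z ω - c|} = {ω | s ^ 2 ≤ (Z ω - c) ^ 2} := by
    ext ω
    simp only [Set.mem_setOf_eq]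
    rw [sq_le_sq, abs_of_pos hs]
  have h := mul_meas_ge_le_integral_of_nonneg (ae_of_all _ fun ω => sq_nonneg (Z ω - c)) hint
    (s ^ 2)
  rw [hset, le_div_iff₀ (pow_pos hs 2), mul_comm]
  exact h

/-- **MEDIAN OF REPLICA MEANS (confidence amplification).**  For mutually independent real
random variables `Y_0, …, Y_{R−1}` with `P(s ≤ |Y_r − c|) ≤ 1/4` for every `r < R`:
`P(#{r < R : s ≤ |Y_r − c|} ≥ R/2) ≤ exp(−R/8)` — on the complement strictly more than half of
the `Y_r` lie in `(c − s, c + s)`, so every sample median of `Y_0, …, Y_{R−1}` does. -/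
theorem measureReal_half_replicas_far_le (hind : iIndepFun Y μ) (hYm : ∀ r, Measurable (Y r))
    (c s : ℝ) (hfar : ∀ r < R, μ.real {ω | s ≤ |Y r ω - c|} ≤ 1 / 4) :
    μ.real {ω | (R : ℝ) / 2 ≤ #{r ∈ range R | s ≤ |Y r ω - c|}} ≤ Real.exp (-(R / 8)) := by
  classical
  -- the indicators and their centred versions
  set I : ℕ → Ω' → ℝ := fun r ω => if s ≤ |Y r ω - c| then 1 else 0 with hI
  have hIm : ∀ r, Measurable (I r) := fun r =>
    Measurable.ite (measurableSet_le measurable_const ((hYm r).sub measurable_const).abs)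
      measurable_const measurable_const
  have hImem : ∀ r, ∀ᵐ ω ∂μ, I r ω ∈ Set.Icc (0 : ℝ) 1 := fun r => ae_of_all _ fun ω => by
    simp only [hI]; split_ifs <;> simp
  have hIint : ∀ r, Integrable (I r) μ := fun r =>
    integrable_of_bounded μ (hIm r) (C := 1) fun ω => by simp only [hI]; split_ifs <;> simp
  -- `E I_r = P(s ≤ |Y_r − c|) ≤ 1/4`
  have hSm : ∀ r, MeasurableSet {ω | s ≤ |Y r ω - c|} := fun r =>
    measurableSet_le measurable_const ((hYm r).sub measurable_const).abs
  have hEI : ∀ r, μ[I r] = μ.real {ω | s ≤ |Y r ω - c|} := fun r => by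
    have h : I r = Set.indicator {ω | s ≤ |Y r ω - c|} (fun _ => (1 : ℝ)) := by
      funext ω; simp only [hI, Set.indicator_apply, Set.mem_setOf_eq]
    rw [h, integral_indicator (hSm r), setIntegral_const, smul_eq_mul, mul_one]
  -- the centred indicators are independent and sub-Gaussian with parameter `1/4`
  set Z : ℕ → Ω' → ℝ := fun r ω => I r ω - μ[I r] with hZ
  have hZind : iIndepFun Z μ := by
    have h := hind.comp (fun r (y : ℝ) => (if s ≤ |y - c| then (1 : ℝ) else 0) - μ[I r])
      fun r => (Measurable.ite (measurableSet_le measurable_const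
        (measurable_id.sub measurable_const).abs) measurable_const measurable_const).sub
        measurable_const
    exact h
  have hZsg : ∀ r < R, HasSubgaussianMGF (Z r) ((‖(1 : ℝ) - 0‖₊ / 2) ^ 2) μ := fun r _ =>
    hasSubgaussianMGF_of_mem_Icc (hIm r).aemeasurable (hImem r)
  have hc : (((‖(1 : ℝ) - 0‖₊ / 2) ^ 2 : ℝ≥0) : ℝ) = 1 / 4 := by
    rw [sub_zero, nnnorm_one]; push_cast; norm_num
  have hR0 : (0 : ℝ) ≤ R / 4 := by positivity
  have hhoeff := HasSubgaussianMGF.measure_sum_range_ge_le_of_iIndepFun hZind (n := R) hZsg hR0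
  rw [hc] at hhoeff
  -- the event `#far ≥ R/2` forces `Σ Z_r ≥ R/4`
  have hsub : {ω | (R : ℝ) / 2 ≤ #{r ∈ range R | s ≤ |Y r ω - c|}}
      ⊆ {ω | (R : ℝ) / 4 ≤ ∑ r ∈ range R, Z r ω} := by
    intro ω hω
    simp only [Set.mem_setOf_eq] at hω ⊢
    rw [natCast_card_filter] at hω
    have hsumI : ∑ r ∈ range R, Z r ω
        = (∑ r ∈ range R, I r ω) - ∑ r ∈ range R, μ[I r] := by
      rw [hZ]; simp only [Finset.sum_sub_distrib]
    have hsumE : ∑ r ∈ range R, μ[I r] ≤ (R : ℝ) / 4 := by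
      calc ∑ r ∈ range R, μ[I r] ≤ ∑ _r ∈ range R, (1 / 4 : ℝ) :=
            Finset.sum_le_sum fun r hr => by rw [hEI r]; exact hfar r (mem_range.1 hr)
        _ = (R : ℝ) / 4 := by rw [Finset.sum_const, Finset.card_range, nsmul_eq_mul]; ring
    have hIω : ∑ r ∈ range R, I r ω = ∑ r ∈ range R, if s ≤ |Y r ω - c| then (1 : ℝ) else 0 := by
      rw [hI]
    rw [hsumI, hIω]
    linarith
  calc μ.real {ω | (R : ℝ) / 2 ≤ #{r ∈ range R | s ≤ |Y r ω - c|}}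
      ≤ μ.real {ω | (R : ℝ) / 4 ≤ ∑ r ∈ range R, Z r ω} := measureReal_mono hsub
    _ ≤ Real.exp (-(R / 4) ^ 2 / (2 * R * (1 / 4))) := hhoeff
    _ ≤ Real.exp (-(R / 8)) := by
        rcases Nat.eq_zero_or_pos R with h0 | hpos
        · subst h0; simp
        · have hRpos : (0 : ℝ) < R := by exact_mod_cast hpos
          refine Real.exp_le_exp.2 (le_of_eq ?_)
          field_simp
          ring

/-- The same from second moments: mutually independent replicas with `E (Y_r − c)² ≤ v` and a
radius `s > 0` with `4 v ≤ s²` ⇒ `P(#{r < R : s ≤ |Y_r − c|} ≥ R/2) ≤ exp(−R/8)`. -/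
theorem measureReal_half_replicas_far_le_of_sq (hind : iIndepFun Y μ) (hYm : ∀ r, Measurable (Y r))
    (hY : ∀ r < R, MemLp (Y r) 2 μ) {c s v : ℝ} (hs : 0 < s) (hvs : 4 * v ≤ s ^ 2)
    (hv : ∀ r < R, ∫ ω, (Y r ω - c) ^ 2 ∂μ ≤ v) :
    μ.real {ω | (R : ℝ) / 2 ≤ #{r ∈ range R | s ≤ |Y r ω - c|}} ≤ Real.exp (-(R / 8)) := by
  refine measureReal_half_replicas_far_le hind hYm c s fun r hr => ?_
  refine (measureReal_abs_sub_ge_le (hY r hr) c hs).trans ?_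
  rw [div_le_iff₀ (pow_pos hs 2)]
  linarith [hv r hr]

end Abstract

/-! ### Replica chains -/

section Chains

variable {Ω : Type*} [MeasurableSpace Ω]
variable {κ : Kernel Ω Ω} [IsMarkovKernel κ] {π : Measure Ω} [IsProbabilityMeasure π] {ε : ℝ≥0∞}
variable {Ω' : Type*} {mΩ' : MeasurableSpace Ω'} {μ : Measure Ω'} [IsProbabilityMeasure μ]
  {X : ℕ → Ω' → (ℕ → Ω)} {μ₀ : ℕ → Measure Ω} [∀ r, IsProbabilityMeasure (μ₀ r)] {R : ℕ}

omit [IsProbabilityMeasure μ] in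
/-- Transport of an expectation along a replica to its path law. -/
theorem integral_comp_eq_of_map_eq {Xr : Ω' → (ℕ → Ω)} (hXr : Measurable Xr)
    {P : Measure (ℕ → Ω)} (hlaw : μ.map Xr = P) {φ : (ℕ → Ω) → ℝ} (hφ : Measurable φ) :
    ∫ ω, φ (Xr ω) ∂μ = ∫ x, φ x ∂P := by
  rw [← hlaw, integral_map hXr.aemeasurable hφ.aestronglyMeasurable]

omit [IsProbabilityMeasure μ] in
/-- A replica time average of a bounded observable is square integrable. -/
theorem memLp_replica_timeAverage {f : Ω → ℝ} (hf : Measurable f) {C : ℝ} (hC : ∀ x, |f x| ≤ C)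
    {N : ℕ} (hN : N ≠ 0) [IsFiniteMeasure μ] (hXm : ∀ r, Measurable (X r)) (r : ℕ) :
    MemLp (fun ω => (∑ i ∈ Finset.range N, f (X r ω i)) / N) 2 μ :=
  MemLp.of_bound (((measurable_timeAverage hf N).comp (hXm r)).aestronglyMeasurable) C
    (ae_of_all _ fun ω => by
      rw [Real.norm_eq_abs]; exact abs_timeAverage_le hC hN (X r ω))

/-- **MEAN-SQUARE ERROR OF THE GRAND MEAN OF INDEPENDENT REPLICA CHAINS.**  Let `π` be invariant
for `κ` with `κ(x, ·) ≥ ε π` (`ε > 0`), `|f| ≤ C`, `C' = C + |πf|`, `N ≥ 1`, `R ≥ 1`.  On a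
probability space carrying pairwise independent paths `X_0, …, X_{R−1}`, `X_r` distributed as the
`κ`-chain from an arbitrary initial law `μ₀ r`, the grand mean `Ȳ` of the replica time averages
`Y_r = (1/N) Σ_{i<N} f(X_r i)` satisfies
`E[(Ȳ − πf)²] ≤ ((2/ε − 1) Var_π f/N + 16 C'²/(ε² N²))/R + (1 − 1/R) (2C'/(εN))²`. -/
theorem replicaChains_mse_le_of_doeblin (hπ : Kernel.Invariant κ π)
    (hmin : ∀ x {B : Set Ω}, MeasurableSet B → ε * π B ≤ κ x B) (hε0 : 0 < ε)
    {f : Ω → ℝ} (hf : Measurable f) {C : ℝ} (hC : ∀ x, |f x| ≤ C) {N : ℕ} (hN : N ≠ 0)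
    (hR : R ≠ 0) (hXm : ∀ r, Measurable (X r))
    (hlaw : ∀ r < R, μ.map (X r) = Kernel.trajMeasure (X := fun _ : ℕ => Ω) (μ₀ r)
      (fun n : ℕ => κ.comap (fun h : (i : ↥(Finset.Iic n)) → Ω => h ⟨n, Finset.mem_Iic.2 le_rfl⟩)
        (measurable_pi_apply _)))
    (hind : ∀ i < R, ∀ j < R, i ≠ j → IndepFun (X i) (X j) μ) :
    ∫ ω, (replicaMean (fun r ω => (∑ i ∈ Finset.range N, f (X r ω i)) / N) R ω - ∫ z, f z ∂π) ^ 2 ∂μ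
      ≤ ((2 / ε.toReal - 1) * (∫ z, (f z - ∫ y, f y ∂π) ^ 2 ∂π) / N
            + 16 * (C + |∫ z, f z ∂π|) ^ 2 / (ε.toReal ^ 2 * (N : ℝ) ^ 2)) / R
        + (1 - 1 / R) * (2 * (C + |∫ z, f z ∂π|) / (ε.toReal * N)) ^ 2 := by
  have hAm : Measurable fun x : ℕ → Ω => (∑ i ∈ Finset.range N, f (x i)) / N :=
    measurable_timeAverage hf N
  have hY2 : ∀ r < R, MemLp (fun ω => (∑ i ∈ Finset.range N, f (X r ω i)) / N) 2 μ :=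
    fun r _ => memLp_replica_timeAverage hf hC hN hXm r
  have hb : ∀ r < R, |μ[fun ω => (∑ i ∈ Finset.range N, f (X r ω i)) / N] - ∫ z, f z ∂π|
      ≤ 2 * (C + |∫ z, f z ∂π|) / (ε.toReal * N) := by
    intro r hr
    have h := integral_comp_eq_of_map_eq (hXm r) (hlaw r hr) hAm
    rw [show μ[fun ω => (∑ i ∈ Finset.range N, f (X r ω i)) / N]
        = ∫ ω, (∑ i ∈ Finset.range N, f (X r ω i)) / N ∂μ from rfl, h]
    exact chain_timeAverage_bias_le_of_doeblin (μ₀ := μ₀ r) hπ hmin hε0 hf hC hN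
  have hv : ∀ r < R, ∫ ω, ((∑ i ∈ Finset.range N, f (X r ω i)) / N - ∫ z, f z ∂π) ^ 2 ∂μ
      ≤ (2 / ε.toReal - 1) * (∫ z, (f z - ∫ y, f y ∂π) ^ 2 ∂π) / N
        + 16 * (C + |∫ z, f z ∂π|) ^ 2 / (ε.toReal ^ 2 * (N : ℝ) ^ 2) := by
    intro r hr
    have h := integral_comp_eq_of_map_eq (hXm r) (hlaw r hr)
      (φ := fun x : ℕ → Ω => ((∑ i ∈ Finset.range N, f (x i)) / N - ∫ z, f z ∂π) ^ 2)
      ((hAm.sub measurable_const).pow_const 2)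
    rw [h]
    have h2 := chain_mse_le_of_doeblin (μ₀ := μ₀ r) hπ hmin hε0 hf hC hN
    rw [autocov_zero] at h2
    exact h2
  have hcov : ∀ a < R, ∀ b < R, a ≠ b →
      cov[fun ω => (∑ i ∈ Finset.range N, f (X a ω i)) / N,
        fun ω => (∑ i ∈ Finset.range N, f (X b ω i)) / N; μ] = 0 := fun a ha b hb' hab =>
    ((hind a ha b hb' hab).comp hAm hAm).covariance_eq_zero (hY2 a ha) (hY2 b hb')
  exact integral_replicaMean_sub_sq_le
    (Y := fun r ω => (∑ i ∈ Finset.range N, f (X r ω i)) / N) hR hY2 hcov hb hv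

/-- **Stationary replicas**: if every replica is started in `π`, the grand mean is unbiased and
`E[(Ȳ − πf)²] ≤ (2/ε − 1) Var_π f / (R N)` — `R` stationary chains of length `N` carry the
certificate of ONE chain of length `R N` (`Scoring/ChainTimeAverage.variance_timeAverage_le_of_doeblin`). -/
theorem replicaChains_mse_le_of_doeblin_stationary (hπ : Kernel.Invariant κ π)
    (hmin : ∀ x {B : Set Ω}, MeasurableSet B → ε * π B ≤ κ x B) (hε0 : 0 < ε)
    {f : Ω → ℝ} (hf : Measurable f) {C : ℝ} (hC : ∀ x, |f x| ≤ C) {N : ℕ} (hN : N ≠ 0)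
    (hR : R ≠ 0) (hXm : ∀ r, Measurable (X r))
    (hlaw : ∀ r < R, μ.map (X r) = Kernel.trajMeasure (X := fun _ : ℕ => Ω) π
      (fun n : ℕ => κ.comap (fun h : (i : ↥(Finset.Iic n)) → Ω => h ⟨n, Finset.mem_Iic.2 le_rfl⟩)
        (measurable_pi_apply _)))
    (hind : ∀ i < R, ∀ j < R, i ≠ j → IndepFun (X i) (X j) μ) :
    ∫ ω, (replicaMean (fun r ω => (∑ i ∈ Finset.range N, f (X r ω i)) / N) R ω - ∫ z, f z ∂π) ^ 2 ∂μ
      ≤ (2 / ε.toReal - 1) * (∫ z, (f z - ∫ y, f y ∂π) ^ 2 ∂π) / ((R : ℝ) * N) := by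
  have hAm : Measurable fun x : ℕ → Ω => (∑ i ∈ Finset.range N, f (x i)) / N :=
    measurable_timeAverage hf N
  have hY2 : ∀ r < R, MemLp (fun ω => (∑ i ∈ Finset.range N, f (X r ω i)) / N) 2 μ :=
    fun r _ => memLp_replica_timeAverage hf hC hN hXm r
  have hb : ∀ r < R, |μ[fun ω => (∑ i ∈ Finset.range N, f (X r ω i)) / N] - ∫ z, f z ∂π| ≤ 0 := by
    intro r hr
    have h := integral_comp_eq_of_map_eq (hXm r) (hlaw r hr) hAm
    rw [show μ[fun ω => (∑ i ∈ Finset.range N, f (X r ω i)) / N]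
        = ∫ ω, (∑ i ∈ Finset.range N, f (X r ω i)) / N ∂μ from rfl, h,
      chain_mean_timeAverage hπ hf hC hN, sub_self, abs_zero]
  have hv : ∀ r < R, ∫ ω, ((∑ i ∈ Finset.range N, f (X r ω i)) / N - ∫ z, f z ∂π) ^ 2 ∂μ
      ≤ (2 / ε.toReal - 1) * (∫ z, (f z - ∫ y, f y ∂π) ^ 2 ∂π) / N := by
    intro r hr
    have h := integral_comp_eq_of_map_eq (hXm r) (hlaw r hr)
      (φ := fun x : ℕ → Ω => ((∑ i ∈ Finset.range N, f (x i)) / N - ∫ z, f z ∂π) ^ 2)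
      ((hAm.sub measurable_const).pow_const 2)
    rw [h, chain_sqError_eq_variance hπ hf hC hN]
    have h2 := variance_timeAverage_le_of_doeblin (κ := κ) hπ hmin hε0 hf hC hN
    rw [autocov_zero] at h2
    exact h2
  have hcov : ∀ a < R, ∀ b < R, a ≠ b →
      cov[fun ω => (∑ i ∈ Finset.range N, f (X a ω i)) / N,
        fun ω => (∑ i ∈ Finset.range N, f (X b ω i)) / N; μ] = 0 := fun a ha b hb' hab =>
    ((hind a ha b hb' hab).comp hAm hAm).covariance_eq_zero (hY2 a ha) (hY2 b hb')
  have h := integral_replicaMean_sub_sq_le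
    (Y := fun r ω => (∑ i ∈ Finset.range N, f (X r ω i)) / N) hR hY2 hcov hb hv
  have hRpos : (0 : ℝ) < R := by exact_mod_cast Nat.pos_of_ne_zero hR
  have hNpos : (0 : ℝ) < N := by exact_mod_cast Nat.pos_of_ne_zero hN
  refine h.trans (le_of_eq ?_)
  field_simp
  ring

/-- **MEDIAN-OF-REPLICA-MEANS CONFIDENCE FOR DOEBLIN CHAINS.**  Same chain hypotheses, the paths
`X_0, …, X_{R−1}` MUTUALLY independent (arbitrary starts `μ₀ r`); if the radius `s > 0` satisfies
`4 ((2/ε − 1) Var_π f/N + 16 C'²/(ε² N²)) ≤ s²` then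
`P(#{r < R : s ≤ |Y_r − πf|} ≥ R/2) ≤ exp(−R/8)` — so every sample median of the replica time
averages is within `s` of `πf` with probability `≥ 1 − e^{−R/8}`. -/
theorem replicaChains_median_confidence_of_doeblin (hπ : Kernel.Invariant κ π)
    (hmin : ∀ x {B : Set Ω}, MeasurableSet B → ε * π B ≤ κ x B) (hε0 : 0 < ε)
    {f : Ω → ℝ} (hf : Measurable f) {C : ℝ} (hC : ∀ x, |f x| ≤ C) {N : ℕ} (hN : N ≠ 0)
    (hXm : ∀ r, Measurable (X r))
    (hlaw : ∀ r < R, μ.map (X r) = Kernel.trajMeasure (X := fun _ : ℕ => Ω) (μ₀ r)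
      (fun n : ℕ => κ.comap (fun h : (i : ↥(Finset.Iic n)) → Ω => h ⟨n, Finset.mem_Iic.2 le_rfl⟩)
        (measurable_pi_apply _)))
    (hind : iIndepFun X μ) {s : ℝ} (hs : 0 < s)
    (hs2 : 4 * ((2 / ε.toReal - 1) * (∫ z, (f z - ∫ y, f y ∂π) ^ 2 ∂π) / N
      + 16 * (C + |∫ z, f z ∂π|) ^ 2 / (ε.toReal ^ 2 * (N : ℝ) ^ 2)) ≤ s ^ 2) :
    μ.real {ω | (R : ℝ) / 2 ≤ #{r ∈ range R |
        s ≤ |(∑ i ∈ Finset.range N, f (X r ω i)) / N - ∫ z, f z ∂π|}}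
      ≤ Real.exp (-(R / 8)) := by
  have hAm : Measurable fun x : ℕ → Ω => (∑ i ∈ Finset.range N, f (x i)) / N :=
    measurable_timeAverage hf N
  have hYm : ∀ r, Measurable fun ω => (∑ i ∈ Finset.range N, f (X r ω i)) / N :=
    fun r => hAm.comp (hXm r)
  have hY2 : ∀ r < R, MemLp (fun ω => (∑ i ∈ Finset.range N, f (X r ω i)) / N) 2 μ :=
    fun r _ => memLp_replica_timeAverage hf hC hN hXm r
  have hYind : iIndepFun (fun r ω => (∑ i ∈ Finset.range N, f (X r ω i)) / N) μ :=
    hind.comp (fun _ => fun x : ℕ → Ω => (∑ i ∈ Finset.range N, f (x i)) / N) fun _ => hAm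
  have hv : ∀ r < R, ∫ ω, ((∑ i ∈ Finset.range N, f (X r ω i)) / N - ∫ z, f z ∂π) ^ 2 ∂μ
      ≤ (2 / ε.toReal - 1) * (∫ z, (f z - ∫ y, f y ∂π) ^ 2 ∂π) / N
        + 16 * (C + |∫ z, f z ∂π|) ^ 2 / (ε.toReal ^ 2 * (N : ℝ) ^ 2) := by
    intro r hr
    have h := integral_comp_eq_of_map_eq (hXm r) (hlaw r hr)
      (φ := fun x : ℕ → Ω => ((∑ i ∈ Finset.range N, f (x i)) / N - ∫ z, f z ∂π) ^ 2)
      ((hAm.sub measurable_const).pow_const 2)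
    rw [h]
    have h2 := chain_mse_le_of_doeblin (μ₀ := μ₀ r) hπ hmin hε0 hf hC hN
    rw [autocov_zero] at h2
    exact h2
  exact measureReal_half_replicas_far_le_of_sq hYind hYm hY2 hs hs2 hv

end Chains

end Summit.Ventures.LatticeQCDFlow.Scoring

end
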